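import Summits.Langlands.Langlands.Theorems.RationalPeriodQuarterTameDecompositionPrelim

/-!
# `TameDecomposition` — child 1 of the lens-1-g38 split of `RationalPeriodQuarter.SemiAnalyticRigidity`

Standalone proof (Mathlib + the preliminaries file) of the statement of the child `TameDecomposition`
(decomp-langlands node `SemiAnalyticRigiditySplit`, split of stmt-Langlands-2806): for `f : ℝ → ℂ` real-analytic
off a finite set whose translation coboundary `f (t+1) - f t` agrees off a finite set with a `PR_ℂ` function, there
is a piecewise rational `ρ` (finitely many real break points, complex fractions) such that `f - ρ` is tame at every
real point (an analytic germ plus ONE fraction on a punctured neighbourhood).  `ρ := ∑_{x ∈ F} 1_{(x,∞)} · (jump at x)`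
where the jumps come from split-tameness at every point (preliminaries: transport from the analytic tail).  The
statement is the child's text VERBATIM (same `let`s), so the rendered route item closes by `exact`.
-/

set_option linter.dupNamespace false

namespace Summit.Langlands.Langlands.Theorems

open Filter Set Topology Polynomial

/-- MAIN THEOREM — the statement of the child `TameDecomposition` of the lens-1-g38 split of
`RationalPeriodQuarter.SemiAnalyticRigidity` (stmt-Langlands-2806), verbatim (same `let`s). -/
theorem tameDecomposition_statement :
    let IsPRC : (ℝ → ℂ) → Prop := fun φ => ∃ F : Finset ℚ, (∀ a b : ℚ, a < b → (∀ r ∈ F, r ≤ a ∨ b ≤ r) → ∃ (P : Polynomial ℂ) (Q : Polynomial ℚ), ∀ x : ℝ, (a : ℝ) < x → x < b → Polynomial.aeval (x : ℂ) Q ≠ 0 ∧ φ x = Polynomial.eval (x : ℂ) P / Polynomial.aeval (x : ℂ) Q) ∧ ∃ B : ℚ, (∃ (P : Polynomial ℂ) (Q : Polynomial ℚ), ∀ x : ℝ, (B : ℝ) < x → Polynomial.aeval (x : ℂ) Q ≠ 0 ∧ φ x = Polynomial.eval (x : ℂ) P / Polynomial.aeval (x : ℂ) Q) ∧ (∃ (P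 : Polynomial ℂ) (Q : Polynomial ℚ), ∀ x : ℝ, x < -(B : ℝ) → Polynomial.aeval (x : ℂ) Q ≠ 0 ∧ φ x = Polynomial.eval (x : ℂ) P / Polynomial.aeval (x : ℂ) Q); let IsPW : (ℝ → ℂ) → Prop := fun ρ => ∃ E : Finset ℝ, (∀ x : ℝ, x ∉ E → ∃ (P Q : Polynomial ℂ), ∀ᶠ (t : ℝ) in nhds x, Polynomial.eval (t : ℂ) Q ≠ 0 ∧ ρ t = Polynomial.eval (t : ℂ) P / Polynomial.eval (t : ℂ) Q) ∧ ∃ B : ℝ, (∃ (P Q : Polynomial ℂ), ∀ t : ℝ, B < t → Polynomial.eval (t : ℂ) Q ≠ 0 ∧ ρ t = Polynomial.eval (t : ℂ) P / Polynomial.eval (t : ℂ) Q) ∧ (∃ (P Q : Polynomial ℂ), ∀ t : ℝ, t < -B → Polynomial.eval (t : ℂ) Q ≠ 0 ∧ ρ t = Polynomial.eval (t : ℂ) P / Polynomial.eval (t : ℂ) Q); let TameAt : (ℝ → ℂ) → ℝ → Prop := fun h x => ∃ g : ℝ → ℂ, AnalyticAt ℝ g x ∧ ∃ (P Q : Polynomial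 ℂ), Q ≠ 0 ∧ ∀ᶠ (t : ℝ) in nhdsWithin x {x}ᶜ, h t = g t + Polynomial.eval (t : ℂ) P / Polynomial.eval (t : ℂ) Q; ∀ f : ℝ → ℂ, (∃ F : Finset ℝ, AnalyticOnNhd ℝ f ((↑F : Set ℝ)ᶜ)) → (∃ q : ℝ → ℂ, IsPRC q ∧ ∀ᶠ t in Filter.cofinite, f (t + 1) - f t = q t) → ∃ ρ : ℝ → ℂ, IsPW ρ ∧ ∀ x : ℝ, TameAt (fun t => f t - ρ t) x := by
  intro IsPRC IsPW TameAt f hF hq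
  dsimp only [IsPRC, IsPW, TameAt] at hF hq ⊢
  classical
  obtain ⟨F, hFana⟩ := hF
  obtain ⟨q, hqPRC, hqid⟩ := hq
  obtain ⟨Fq, hFq, -⟩ := hqPRC
  -- analytic tail bound
  obtain ⟨M₀, hM₀⟩ : ∃ M₀ : ℝ, ∀ x, M₀ ≤ x → AnalyticAt ℝ f x := by
    refine ⟨∑ r ∈ F, |r| + 1, fun x hx => hFana x ?_⟩
    simp only [Set.mem_compl_iff, Finset.mem_coe]
    intro hxF
    have h1 : |x| ≤ ∑ r ∈ F, |r| :=
      Finset.single_le_sum (f := fun r : ℝ => |r|) (fun _ _ => abs_nonneg _) hxF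
    have h2 := le_abs_self x
    linarith
  -- local pieces of q, punctured identity, split-tameness everywhere
  have hqloc := tameDecomp_prc_local q Fq hFq
  have hid : ∀ x : ℝ, ∀ᶠ (t : ℝ) in 𝓝[≠] x, f (t + 1) - f t = q t :=
    fun x => tameDecomp_eventually_nhdsNE_of_cofinite hqid x
  have hST := tameDecomp_splitTame_all f q M₀ hM₀ hqloc hid
  choose g hg Pm Qm Pp Qp hL hR using hST
  -- the chosen denominators are nonzero polynomials
  have hQm0 : ∀ x, Qm x ≠ 0 := by
    intro x h0
    obtain ⟨t, ht⟩ := (hL x).exists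
    exact ht.1 (by simp [h0])
  have hQp0 : ∀ x, Qp x ≠ 0 := by
    intro x h0
    obtain ⟨t, ht⟩ := (hR x).exists
    exact ht.1 (by simp [h0])
  -- jump fractions `Pj x / Qj x = Pp x / Qp x - Pm x / Qm x`
  obtain ⟨Pj, hPj⟩ : ∃ Pj : ℝ → ℂ[X], Pj = fun x => Pp x * Qm x - Qp x * Pm x := ⟨_, rfl⟩
  obtain ⟨Qj, hQj⟩ : ∃ Qj : ℝ → ℂ[X], Qj = fun x => Qp x * Qm x := ⟨_, rfl⟩
  have hQj_eval : ∀ x (z : ℂ), (Qj x).eval z = (Qp x).eval z * (Qm x).eval z := by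
    intro x z; rw [hQj]; simp only [Polynomial.eval_mul]
  have hQj0 : ∀ x, Qj x ≠ 0 := by
    intro x; rw [hQj]; exact mul_ne_zero (hQp0 x) (hQm0 x)
  have hJ : ∀ x (z : ℂ), (Qp x).eval z ≠ 0 → (Qm x).eval z ≠ 0 →
      (Pj x).eval z / (Qj x).eval z =
        (Pp x).eval z / (Qp x).eval z - (Pm x).eval z / (Qm x).eval z := by
    intro x z hp hm
    rw [div_sub_div _ _ hp hm, hPj, hQj]
    simp only [Polynomial.eval_mul, Polynomial.eval_sub]
  -- ρ := ∑_{x ∈ F} 1_{(x,∞)} · (Pj x / Qj x)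
  obtain ⟨ρ, hρ⟩ : ∃ ρ : ℝ → ℂ, ρ = fun t =>
      ∑ x ∈ F, (if x < t then (Pj x).eval (t : ℂ) / (Qj x).eval (t : ℂ) else 0) := ⟨_, rfl⟩
  -- punctured-eventually, all `Qj x` (x ∈ F) are nonzero
  have hevQ : ∀ y : ℝ, ∀ᶠ (t : ℝ) in 𝓝[≠] y, ∀ x ∈ F, (Qj x).eval (t : ℂ) ≠ 0 := by
    intro y
    refine (Filter.eventually_all_finset F).2 fun x _ => ?_
    exact tameDecomp_eventually_nhdsNE_of_cofinite
      (tameDecomp_eventually_cofinite_eval_ne_zero (hQj0 x)) y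
  -- eventually, the order of t relative to the points of F other than y is that of y
  have hevOrd : ∀ y : ℝ, ∀ᶠ (t : ℝ) in 𝓝 y, ∀ x ∈ F.erase y, (x < t ↔ x < y) := by
    intro y
    refine (Filter.eventually_all_finset _).2 fun x hx => ?_
    have hxy : x ≠ y := (Finset.mem_erase.1 hx).1
    rcases lt_or_gt_of_ne hxy with h | h
    · filter_upwards [Ioi_mem_nhds h] with t ht
      exact ⟨fun _ => h, fun _ => ht⟩
    · filter_upwards [Iio_mem_nhds h] with t ht
      exact ⟨fun h' => absurd (lt_trans h' ht) (lt_irrefl x), fun h' => absurd (lt_trans h h') (lt_irrefl y)⟩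
  -- the sum over `F.erase y` is ONE fraction wherever the denominators are nonzero and the order is that of y
  have hsumF : ∀ y : ℝ, ∃ P₀ Q₀ : ℂ[X], Q₀ ≠ 0 ∧ ∀ t : ℝ, (∀ x ∈ F, (Qj x).eval (t : ℂ) ≠ 0) →
      (∀ x ∈ F.erase y, (x < t ↔ x < y)) →
      Q₀.eval (t : ℂ) ≠ 0 ∧
        (∑ x ∈ F.erase y, (if x < t then (Pj x).eval (t : ℂ) / (Qj x).eval (t : ℂ) else 0)) =
          P₀.eval (t : ℂ) / Q₀.eval (t : ℂ) := by
    intro y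
    obtain ⟨P₀, hP₀⟩ := tameDecomp_sum_fractions ((F.erase y).filter (fun x => x < y)) Pj Qj
    refine ⟨P₀, ∏ x ∈ (F.erase y).filter (fun x => x < y), Qj x,
      Finset.prod_ne_zero_iff.2 (fun x _ => hQj0 x), fun t hQt hOt => ?_⟩
    have hQjt : ∀ x ∈ (F.erase y).filter (fun x => x < y), (Qj x).eval (t : ℂ) ≠ 0 := fun x hx =>
      hQt x (Finset.mem_of_mem_erase (Finset.mem_filter.1 hx).1)
    refine ⟨by rw [Polynomial.eval_prod]; exact Finset.prod_ne_zero_iff.2 hQjt, ?_⟩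
    rw [← hP₀ (t : ℂ) hQjt, Finset.sum_filter]
    exact Finset.sum_congr rfl fun x hx => by simp only [hOt x hx]
  -- the finite exceptional set E := F ∪ (real zeros of the Qj x, x ∈ F) and the tail bound B
  have hZfin : Set.Finite {t : ℝ | ∃ x ∈ F, (Qj x).eval (t : ℂ) = 0} := by
    have : {t : ℝ | ∃ x ∈ F, (Qj x).eval (t : ℂ) = 0} = ⋃ x ∈ F, {t : ℝ | (Qj x).eval (t : ℂ) = 0} := by
      ext t; simp
    rw [this]
    exact Set.Finite.biUnion F.finite_toSet fun x _ => tameDecomp_finite_eval_eq_zero (hQj0 x)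
  obtain ⟨E, hE⟩ : ∃ E : Finset ℝ, E = F ∪ hZfin.toFinset := ⟨_, rfl⟩
  have hEF : ∀ x ∈ F, x ∈ E := fun x hx => hE ▸ Finset.mem_union_left _ hx
  have hEZ : ∀ t, t ∉ E → ∀ x ∈ F, (Qj x).eval (t : ℂ) ≠ 0 := by
    intro t ht x hx h0
    exact ht (hE ▸ Finset.mem_union_right _ (hZfin.mem_toFinset.2 ⟨x, hx, h0⟩))
  obtain ⟨B, hB⟩ : ∃ B : ℝ, B = ∑ e ∈ E, |e| + 1 := ⟨_, rfl⟩
  have hBlt : ∀ e ∈ E, |e| < B := by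
    intro e he
    have := Finset.single_le_sum (f := fun e : ℝ => |e|) (fun _ _ => abs_nonneg _) he
    rw [hB]; linarith
  have hBpos : 0 < B := by
    rw [hB]; have := Finset.sum_nonneg (fun e (_ : e ∈ E) => abs_nonneg e); linarith
  refine ⟨ρ, ⟨E, ?_, B, ?_, ?_⟩, ?_⟩
  · -- IsPW, local clause off E
    intro y hy
    have hyF : y ∉ F := fun h => hy (hEF y h)
    obtain ⟨P₀, Q₀, hQ₀, hsum⟩ := hsumF y
    refine ⟨P₀, Q₀, ?_⟩
    have hcont : ∀ x ∈ F, ∀ᶠ (t : ℝ) in 𝓝 y, (Qj x).eval (t : ℂ) ≠ 0 := by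
      intro x hx
      have hc : Continuous fun t : ℝ => (Qj x).eval (t : ℂ) :=
        (Polynomial.continuous (Qj x)).comp Complex.continuous_ofReal
      exact hc.continuousAt.eventually_ne (hEZ y hy x hx)
    filter_upwards [(Filter.eventually_all_finset F).2 hcont, hevOrd y] with t hQt hOt
    obtain ⟨h1, h2⟩ := hsum t hQt hOt
    refine ⟨h1, ?_⟩
    rw [hρ]
    simp only
    rw [← Finset.erase_eq_of_notMem hyF]
    exact h2
  · -- right tail
    obtain ⟨P', hP'⟩ := tameDecomp_sum_fractions F Pj Qj
    refine ⟨P', ∏ x ∈ F, Qj x, fun t ht => ?_⟩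
    have htE : t ∉ E := by
      intro h; have := hBlt t h; have := le_abs_self t; linarith
    have hQt := hEZ t htE
    refine ⟨by rw [Polynomial.eval_prod]; exact Finset.prod_ne_zero_iff.2 hQt, ?_⟩
    rw [hρ]
    simp only
    rw [← hP' (t : ℂ) hQt]
    refine Finset.sum_congr rfl fun x hx => ?_
    have hxt : x < t := by
      have := hBlt x (hEF x hx); have := le_abs_self x; linarith
    simp [hxt]
  · -- left tail
    refine ⟨0, 1, fun t ht => ⟨by simp, ?_⟩⟩
    rw [hρ]
    simp only [Polynomial.eval_zero, Polynomial.eval_one, zero_div]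
    refine Finset.sum_eq_zero fun x hx => ?_
    have hxt : ¬ x < t := by
      have := hBlt x (hEF x hx); have := neg_abs_le x; intro h; linarith
    simp [hxt]
  · -- TameAt (f - ρ) at every point y
    intro y
    obtain ⟨P₀, Q₀, hQ₀, hsum⟩ := hsumF y
    have hOrd' : ∀ᶠ (t : ℝ) in 𝓝[≠] y, ∀ x ∈ F.erase y, (x < t ↔ x < y) :=
      mem_nhdsWithin_of_mem_nhds (hevOrd y)
    by_cases hyF : y ∈ F
    · refine ⟨g y, hg y, Pm y * Q₀ - Qm y * P₀, Qm y * Q₀, mul_ne_zero (hQm0 y) hQ₀, ?_⟩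
      have hsplit : ∀ t : ℝ, ρ t =
          (if y < t then (Pj y).eval (t : ℂ) / (Qj y).eval (t : ℂ) else 0) +
          ∑ x ∈ F.erase y, (if x < t then (Pj x).eval (t : ℂ) / (Qj x).eval (t : ℂ) else 0) := by
        intro t; rw [hρ]
        exact (Finset.add_sum_erase F
          (fun x => if x < t then (Pj x).eval (t : ℂ) / (Qj x).eval (t : ℂ) else 0) hyF).symm
      apply tameDecomp_eventually_nhdsNE
      · -- left of y
        filter_upwards [hL y, (hevQ y).filter_mono (nhdsLT_le_nhdsNE y),
          hOrd'.filter_mono (nhdsLT_le_nhdsNE y), self_mem_nhdsWithin] with t hft hQt hOt (hty : t < y)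
        obtain ⟨hQ₀t, hs⟩ := hsum t hQt hOt
        have hρt : ρ t = P₀.eval (t : ℂ) / Q₀.eval (t : ℂ) := by
          rw [hsplit t, hs, if_neg (not_lt.2 hty.le), zero_add]
        rw [hρt, hft.2, add_sub_assoc, div_sub_div _ _ hft.1 hQ₀t]
        simp only [Polynomial.eval_mul, Polynomial.eval_sub]
      · -- right of y
        filter_upwards [hR y, (hevQ y).filter_mono (nhdsGT_le_nhdsNE y),
          hOrd'.filter_mono (nhdsGT_le_nhdsNE y), self_mem_nhdsWithin] with t hft hQt hOt (hty : y < t)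
        obtain ⟨hQ₀t, hs⟩ := hsum t hQt hOt
        have hQpt : (Qp y).eval (t : ℂ) ≠ 0 := by
          have := hQt y hyF; rw [hQj_eval] at this; exact left_ne_zero_of_mul this
        have hQmt : (Qm y).eval (t : ℂ) ≠ 0 := by
          have := hQt y hyF; rw [hQj_eval] at this; exact right_ne_zero_of_mul this
        have hρt : ρ t = ((Pp y).eval (t : ℂ) / (Qp y).eval (t : ℂ) -
            (Pm y).eval (t : ℂ) / (Qm y).eval (t : ℂ)) + P₀.eval (t : ℂ) / Q₀.eval (t : ℂ) := by
          rw [hsplit t, hs, if_pos hty, hJ y (t : ℂ) hQpt hQmt]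
        rw [hρt, hft.2]
        have : g y t + Polynomial.eval (↑t) (Pp y) / Polynomial.eval (↑t) (Qp y) -
            (Polynomial.eval (↑t) (Pp y) / Polynomial.eval (↑t) (Qp y) -
              Polynomial.eval (↑t) (Pm y) / Polynomial.eval (↑t) (Qm y) +
              Polynomial.eval (↑t) P₀ / Polynomial.eval (↑t) Q₀) =
            g y t + (Polynomial.eval (↑t) (Pm y) / Polynomial.eval (↑t) (Qm y) -
              Polynomial.eval (↑t) P₀ / Polynomial.eval (↑t) Q₀) := by ring
        rw [this, div_sub_div _ _ hQmt hQ₀t]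
        simp only [Polynomial.eval_mul, Polynomial.eval_sub]
    · have hyana : AnalyticAt ℝ f y := hFana y (by simpa using hyF)
      refine ⟨f, hyana, -P₀, Q₀, hQ₀, ?_⟩
      filter_upwards [hevQ y, hOrd'] with t hQt hOt
      obtain ⟨hQ₀t, hs⟩ := hsum t hQt hOt
      have hρt : ρ t = P₀.eval (t : ℂ) / Q₀.eval (t : ℂ) := by
        rw [hρ]; simp only; rw [← Finset.erase_eq_of_notMem hyF]; exact hs
      rw [hρt, Polynomial.eval_neg, neg_div, sub_eq_add_neg]

end Summit.Langlands.Langlands.Theorems
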